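import Summits.Schanuel.Schanuel.Theorems.SoloInformedX193Lives

/-!
# X193 kernel line, file F7c: harmonic sums and the demand side of the count

Solo seat `solo-Schanuel-informed`, X193 kernel programme (design note
`work/s213/X193-KERNEL-DESIGN.md`, Amendments A4-A6; pen proof `work/s194/X193-pen.md` §7;
file F7a = `SoloInformedX193Lives`).

Pen §7 double-counts the incidences (column `k ≤ K'`, level `n ∈ [N₀, N₁]`) served by a
cheap capped main server.  The DEMAND side is elementary: at every level all but
`A₆ n^{σ-γ}` of the `K'` columns are served (hypothesis (H6) of file F7a, unpacked by
`SoloServiceData.cheapAssignable_choose` into good-column sets `G n` with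
`|G n| ≥ K' - A₆ n^{σ-γ}`), so that
`Σ_{n ∈ [N₀, N₁]} |G n| / n ≥ (K' - A₆ N₁^{σ-γ}) Σ_{n ∈ [N₀, N₁]} 1/n`
`≥ (K' - A₆ N₁^{σ-γ}) log ((N₁+1)/N₀) ≥ (K' - A₆ N₁^{σ-γ}) · a · log N₀`
when `N₀^{1+a} ≤ N₁ + 1` (the window `N₁ = ⌊N₀^{1+a}⌋₊` of the endgame, `a` from
`soloX_exists_rate` of file F1).  This file proves these inequalities together with the
harmonic-sum toolkit used on BOTH sides of the count (the supply side, files F7b/F7d,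
needs the upper bounds):

* `soloX_log_le_harmonic_Icc`: `log ((B+1)/A) ≤ Σ_{n ∈ [A,B]} 1/n` (`1 ≤ A ≤ B+1`);
* `soloX_harmonic_Icc_le`: `Σ_{n ∈ [A,B]} 1/n ≤ 1/A + log (B/A)` (`1 ≤ A ≤ B`), and the
  weighted level sum `soloX_level_sum_le` (post-composes `lives_cost_le_harmonic` of F7a);
* `soloX_harmonic_le_of_bounds`: for a finite set `S` of naturals inside a real interval
  `[x, y]`, `0 < x ≤ y`: `Σ_{n ∈ S} 1/n ≤ 1/x + log (y/x)` (the per-life window sum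
  `H(P,e) = Σ_{n ∈ lifeLevels} 1/n` of pen §7 is bounded this way in file F7b);
* `soloX_log_window_lower` (`a log N₀ ≤ log ((N₁+1)/N₀)` when `N₀^{1+a} ≤ N₁+1`) and
  `soloX_log_window_upper` (`log (y/x) ≤ (1+a) log N₀ - log x` when `y ≤ N₀^{1+a}`);
* `soloX_demand_lower`, `soloX_demand_lower_log`, `soloX_demand_lower_rate`: the three
  displayed demand inequalities.

Pure real analysis and `Finset` algebra (integral comparison for the antitone `x ↦ x⁻¹`:
Mathlib `AntitoneOn.integral_le_sum_Ico`, `AntitoneOn.sum_le_integral_Ico`,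
`integral_inv_of_pos`); the service structure appears only in the docstrings.  No sorries.
-/

namespace Summit.Schanuel.Schanuel.Theorems

open Finset

/-! ### Harmonic sums against logarithms -/

/-- LOWER harmonic bound: for naturals `1 ≤ A ≤ B + 1`,
`log ((B + 1) / A) ≤ Σ_{n ∈ [A, B]} 1 / n`
(the integral of the antitone `x ↦ x⁻¹` over `[A, B+1]` is below its left Riemann sum). -/
theorem soloX_log_le_harmonic_Icc {A B : ℕ} (hA : 1 ≤ A) (hAB : A ≤ B + 1) :
    Real.log (((B : ℝ) + 1) / A) ≤ ∑ n ∈ Finset.Icc A B, 1 / (n : ℝ) := by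
  have hA0 : (0 : ℝ) < A := by exact_mod_cast hA
  have hB1 : (0 : ℝ) < ((B + 1 : ℕ) : ℝ) := by positivity
  have hanti : AntitoneOn (fun x : ℝ => x⁻¹) (Set.Icc (A : ℝ) ((B + 1 : ℕ) : ℝ)) :=
    inv_antitoneOn_Icc_right hA0
  have h1 : ∫ x in (A : ℝ)..((B + 1 : ℕ) : ℝ), x⁻¹ ≤
      ∑ n ∈ Finset.Ico A (B + 1), ((n : ℝ))⁻¹ := hanti.integral_le_sum_Ico hAB
  rw [integral_inv_of_pos hA0 hB1, Finset.Ico_add_one_right_eq_Icc] at h1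
  push_cast at h1
  simpa only [one_div] using h1

/-- UPPER harmonic bound: for naturals `1 ≤ A ≤ B`,
`Σ_{n ∈ [A, B]} 1 / n ≤ 1 / A + log (B / A)`
(the terms `A + 1 ≤ n ≤ B` form a right Riemann sum of `x ↦ x⁻¹` over `[A, B]`). -/
theorem soloX_harmonic_Icc_le {A B : ℕ} (hA : 1 ≤ A) (hAB : A ≤ B) :
    ∑ n ∈ Finset.Icc A B, 1 / (n : ℝ) ≤ 1 / (A : ℝ) + Real.log ((B : ℝ) / A) := by
  have hA0 : (0 : ℝ) < A := by exact_mod_cast hA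
  have hB0 : (0 : ℝ) < B := by exact_mod_cast lt_of_lt_of_le (by omega : 0 < A) hAB
  have hanti : AntitoneOn (fun x : ℝ => x⁻¹) (Set.Icc (A : ℝ) (B : ℝ)) :=
    inv_antitoneOn_Icc_right hA0
  have h1 : ∑ i ∈ Finset.Ico A B, (((i + 1 : ℕ) : ℝ))⁻¹ ≤ ∫ x in (A : ℝ)..(B : ℝ), x⁻¹ :=
    hanti.sum_le_integral_Ico hAB
  rw [integral_inv_of_pos hA0 hB0] at h1
  have h2 : ∑ n ∈ Finset.Ioc A B, 1 / (n : ℝ) =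
      ∑ i ∈ Finset.Ico A B, (((i + 1 : ℕ) : ℝ))⁻¹ := by
    rw [← Finset.Ico_add_one_add_one_eq_Ioc, ← Finset.map_add_right_Ico, Finset.sum_map]
    refine Finset.sum_congr rfl fun i _ => ?_
    simp [addRightEmbedding_apply, one_div]
  rw [← Finset.Ioc_insert_left hAB, Finset.sum_insert Finset.left_notMem_Ioc, h2]
  linarith

/-- The weighted level sum of file F7a (`lives_cost_le_harmonic`): for `1 ≤ A ≤ Bm` and a
weight `c ≥ 0`, `Σ_{ℓ ∈ [A, Bm]} c / ℓ ≤ c (1 / A + log (Bm / A))`. -/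
theorem soloX_level_sum_le {A Bm : ℕ} (hA : 1 ≤ A) (hAB : A ≤ Bm) {c : ℝ} (hc : 0 ≤ c) :
    ∑ ℓ ∈ Finset.Icc A Bm, c / (ℓ : ℝ) ≤ c * (1 / (A : ℝ) + Real.log ((Bm : ℝ) / A)) := by
  have h : ∑ ℓ ∈ Finset.Icc A Bm, c / (ℓ : ℝ) = c * ∑ ℓ ∈ Finset.Icc A Bm, 1 / (ℓ : ℝ) := by
    rw [Finset.mul_sum]
    refine Finset.sum_congr rfl fun ℓ _ => ?_
    rw [mul_one_div]
  rw [h]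
  exact mul_le_mul_of_nonneg_left (soloX_harmonic_Icc_le hA hAB) hc

/-- Harmonic sum over a finite set `S` of naturals placed in a real interval `[x, y]` with
`0 < x ≤ y`: `Σ_{n ∈ S} 1 / n ≤ 1 / x + log (y / x)`
(`S ⊆ [⌈x⌉₊, ⌊y⌋₊]`, then `soloX_harmonic_Icc_le` and monotonicity; the empty case holds
because `log (y / x) ≥ 0`).  In file F7b, `S = lifeLevels` of a cheap life and `[x, y]`
is its window `[n_lo(e), n_hi(e)]` from `window_upper` / `window_lower` of file F5b. -/
theorem soloX_harmonic_le_of_bounds (S : Finset ℕ) {x y : ℝ} (hx : 0 < x) (hxy : x ≤ y)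
    (hS : ∀ n ∈ S, x ≤ (n : ℝ) ∧ (n : ℝ) ≤ y) :
    ∑ n ∈ S, 1 / (n : ℝ) ≤ 1 / x + Real.log (y / x) := by
  have hlog : 0 ≤ Real.log (y / x) := Real.log_nonneg ((one_le_div hx).mpr hxy)
  have hx1 : 0 < 1 / x := by positivity
  set A := ⌈x⌉₊ with hAdef
  set B := ⌊y⌋₊ with hBdef
  have hsub : S ⊆ Finset.Icc A B := by
    intro n hn
    obtain ⟨h1, h2⟩ := hS n hn
    rw [Finset.mem_Icc]
    exact ⟨Nat.ceil_le.mpr h1, Nat.le_floor h2⟩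
  have hle : ∑ n ∈ S, 1 / (n : ℝ) ≤ ∑ n ∈ Finset.Icc A B, 1 / (n : ℝ) :=
    Finset.sum_le_sum_of_subset_of_nonneg hsub fun n _ _ => by positivity
  refine hle.trans ?_
  by_cases hAB : A ≤ B
  · have hA1 : 1 ≤ A := Nat.ceil_pos.mpr hx
    have hxA : x ≤ (A : ℝ) := Nat.le_ceil x
    have hBy : (B : ℝ) ≤ y := Nat.floor_le (hx.le.trans hxy)
    have hA0 : (0 : ℝ) < A := lt_of_lt_of_le hx hxA
    have hB0 : (0 : ℝ) < B := by exact_mod_cast lt_of_lt_of_le (by omega : 0 < A) hAB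
    have h1 : 1 / (A : ℝ) ≤ 1 / x := one_div_le_one_div_of_le hx hxA
    have h2 : Real.log ((B : ℝ) / A) ≤ Real.log (y / x) := by
      apply Real.log_le_log (div_pos hB0 hA0)
      exact div_le_div₀ (hx.le.trans hxy) hBy hx hxA
    exact (soloX_harmonic_Icc_le hA1 hAB).trans (by linarith)
  · rw [Finset.Icc_eq_empty_iff.mpr hAB, Finset.sum_empty]
    linarith

/-! ### The two windows in logarithmic scale -/

/-- The demand window: if `1 ≤ N₀` and `N₀^{1+a} ≤ N₁ + 1` (e.g. `N₁ = ⌊N₀^{1+a}⌋₊`),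
then `a · log N₀ ≤ log ((N₁ + 1) / N₀)`. -/
theorem soloX_log_window_lower {N₀ N₁ : ℕ} {a : ℝ} (hN₀ : 1 ≤ N₀)
    (hN₁ : (N₀ : ℝ) ^ (1 + a) ≤ (N₁ : ℝ) + 1) :
    a * Real.log N₀ ≤ Real.log (((N₁ : ℝ) + 1) / N₀) := by
  have h0 : (0 : ℝ) < N₀ := by exact_mod_cast hN₀
  rw [← Real.log_rpow h0]
  apply Real.log_le_log (Real.rpow_pos_of_pos h0 a)
  rw [le_div_iff₀ h0]
  calc (N₀ : ℝ) ^ a * N₀ = (N₀ : ℝ) ^ (1 + a) := by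
        rw [Real.rpow_add h0, Real.rpow_one, mul_comm]
    _ ≤ (N₁ : ℝ) + 1 := hN₁

/-- The demand window for `N₁ := ⌊N₀^{1+a}⌋₊`: `a · log N₀ ≤ log ((⌊N₀^{1+a}⌋₊ + 1) / N₀)`. -/
theorem soloX_log_window_lower_floor {N₀ : ℕ} (a : ℝ) (hN₀ : 1 ≤ N₀) :
    a * Real.log N₀ ≤ Real.log (((⌊(N₀ : ℝ) ^ (1 + a)⌋₊ : ℝ) + 1) / N₀) :=
  soloX_log_window_lower hN₀ (Nat.lt_floor_add_one _).le

/-- The supply window: if `1 ≤ N₀`, `0 < x ≤ y ≤ N₀^{1+a}`, then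
`log (y / x) ≤ (1 + a) log N₀ - log x`. -/
theorem soloX_log_window_upper {N₀ : ℕ} {a x y : ℝ} (hN₀ : 1 ≤ N₀) (hx : 0 < x)
    (hxy : x ≤ y) (hy : y ≤ (N₀ : ℝ) ^ (1 + a)) :
    Real.log (y / x) ≤ (1 + a) * Real.log N₀ - Real.log x := by
  have h0 : (0 : ℝ) < N₀ := by exact_mod_cast hN₀
  have hy0 : 0 < y := lt_of_lt_of_le hx hxy
  rw [Real.log_div hy0.ne' hx.ne', ← Real.log_rpow h0]
  have := Real.log_le_log hy0 hy
  linarith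

/-! ### The demand side of the count -/

/-- DEMAND, termwise form (pen §7): if on a finite set of levels `W`, all `≤ N₁`, the good
columns satisfy `K - A₆ n^δ ≤ |G n|` with `A₆ ≥ 0`, `δ ≥ 0` (the shape delivered by
`SoloServiceData.cheapAssignable_choose` with `δ = σ - γ`), then
`(K - A₆ N₁^δ) · Σ_{n ∈ W} 1 / n ≤ Σ_{n ∈ W} |G n| / n`. -/
theorem soloX_demand_lower (W : Finset ℕ) (G : ℕ → Finset ℕ) {K A₆ δ : ℝ} {N₁ : ℕ}
    (hA₆ : 0 ≤ A₆) (hδ : 0 ≤ δ) (hW : ∀ n ∈ W, n ≤ N₁)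
    (hG : ∀ n ∈ W, K - A₆ * (n : ℝ) ^ δ ≤ ((G n).card : ℝ)) :
    (K - A₆ * (N₁ : ℝ) ^ δ) * ∑ n ∈ W, 1 / (n : ℝ) ≤
      ∑ n ∈ W, ((G n).card : ℝ) / n := by
  rw [Finset.mul_sum]
  apply Finset.sum_le_sum
  intro n hn
  have hmono : (n : ℝ) ^ δ ≤ (N₁ : ℝ) ^ δ :=
    Real.rpow_le_rpow (Nat.cast_nonneg n) (by exact_mod_cast hW n hn) hδ
  have hle : K - A₆ * (N₁ : ℝ) ^ δ ≤ ((G n).card : ℝ) := by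
    have h1 := hG n hn
    have h2 := mul_le_mul_of_nonneg_left hmono hA₆
    linarith
  rw [mul_one_div]
  exact div_le_div_of_nonneg_right hle (Nat.cast_nonneg n)

/-- DEMAND, logarithmic form on the window `W = [N₀, N₁]`, `1 ≤ N₀ ≤ N₁ + 1`: if moreover
`A₆ N₁^δ ≤ K` (few exceptional columns), then
`(K - A₆ N₁^δ) · log ((N₁ + 1) / N₀) ≤ Σ_{n ∈ [N₀, N₁]} |G n| / n`. -/
theorem soloX_demand_lower_log (G : ℕ → Finset ℕ) {K A₆ δ : ℝ} {N₀ N₁ : ℕ}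
    (hA₆ : 0 ≤ A₆) (hδ : 0 ≤ δ) (hN₀ : 1 ≤ N₀) (hN : N₀ ≤ N₁ + 1)
    (hK : A₆ * (N₁ : ℝ) ^ δ ≤ K)
    (hG : ∀ n ∈ Finset.Icc N₀ N₁, K - A₆ * (n : ℝ) ^ δ ≤ ((G n).card : ℝ)) :
    (K - A₆ * (N₁ : ℝ) ^ δ) * Real.log (((N₁ : ℝ) + 1) / N₀) ≤
      ∑ n ∈ Finset.Icc N₀ N₁, ((G n).card : ℝ) / n := by
  have h1 := soloX_demand_lower (Finset.Icc N₀ N₁) G hA₆ hδ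
    (fun n hn => (Finset.mem_Icc.mp hn).2) hG
  have h2 := soloX_log_le_harmonic_Icc hN₀ hN
  have hK' : 0 ≤ K - A₆ * (N₁ : ℝ) ^ δ := by linarith
  exact (mul_le_mul_of_nonneg_left h2 hK').trans h1

/-- DEMAND, rate form (the left end of the endgame of pen §7): on the window `[N₀, N₁]`
with `1 ≤ N₀ ≤ N₁ + 1` and `N₀^{1+a} ≤ N₁ + 1` (e.g. `N₁ = ⌊N₀^{1+a}⌋₊`, `a` the rate of
`soloX_exists_rate`), and `A₆ N₁^δ ≤ K`:
`(K - A₆ N₁^δ) · a · log N₀ ≤ Σ_{n ∈ [N₀, N₁]} |G n| / n`. -/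
theorem soloX_demand_lower_rate (G : ℕ → Finset ℕ) {K A₆ δ a : ℝ} {N₀ N₁ : ℕ}
    (hA₆ : 0 ≤ A₆) (hδ : 0 ≤ δ) (hN₀ : 1 ≤ N₀) (hN : N₀ ≤ N₁ + 1)
    (hN₁ : (N₀ : ℝ) ^ (1 + a) ≤ (N₁ : ℝ) + 1) (hK : A₆ * (N₁ : ℝ) ^ δ ≤ K)
    (hG : ∀ n ∈ Finset.Icc N₀ N₁, K - A₆ * (n : ℝ) ^ δ ≤ ((G n).card : ℝ)) :
    (K - A₆ * (N₁ : ℝ) ^ δ) * (a * Real.log N₀) ≤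
      ∑ n ∈ Finset.Icc N₀ N₁, ((G n).card : ℝ) / n := by
  have hK' : 0 ≤ K - A₆ * (N₁ : ℝ) ^ δ := by linarith
  exact (mul_le_mul_of_nonneg_left (soloX_log_window_lower hN₀ hN₁) hK').trans
    (soloX_demand_lower_log G hA₆ hδ hN₀ hN hK hG)

end Summit.Schanuel.Schanuel.Theorems
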